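import Summits.QuantumFields.BalabanUV.T4Continuum.Support.B13HistMeasurable
import Summits.QuantumFields.BalabanUV.T4Continuum.Support.InsertionLinearClass

/-!
# B13HistWitness — NON-VACUITY of row O1-c's history spaces: a concrete measurable potential frame, a concrete measurable
# table built by `ofMeasPotentials`, its (1.42) read-out in closed form, its norm, and the weak-measurability clause of the
# exp-linear structure instantiated against Lebesgue measure (cell `pub-balaban`, T⁴ fan-out, claim table row O1-c)

Unit `b2b-balaban-t4-ne5-formalise-leaf-06` (NE5 formalisation swarm, leaf prover 06).  Summits-side bookkeeping (a TOY; nothing of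
the manuscripts under audit is modelled or asserted).  HONEST FRAMING: rung (B)+1 of the FINITE-VOLUME T⁴ continuum programme — NOT
infinite volume, NOT a mass gap, NOT the Clay problem, NOT a proof of NE5.  HONEST DEPENDENCY (cell line, verbatim): continuum YM on
T⁴ ⇐ BetaPertH ∧ nine spine estimates (0/9 proved); BetaPertH ⇐ (D1) ∧ (D4) ∧ CAP+tail; G-an2-4 gates asym, D1 and NE2/3/4.

WHAT THIS FILE SHOWS (kernel-checked, no hypothesis left open).  Over the two-line toy carriers `InsertionLinearClass.linToyCarriers`
(domains = creation steps, tree length `0`) and the all-ones constants `toyConsts` (so that both level formats `level136`, `level143`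
equal `1` at tree length `0`: `level136_toy`, `level143_toy`): the measurable potential frame `toyFrame` (one real bond variable per
domain, Borel structure, `Bv Y φ () = φ`), the measurable table `toyTable := ofMeasPotentials (V″ = cos φ) (Q = sin φ) 1 …`, its
read-outs (`VppM_toyTable`, `QkerM_toyTable`), its potential value `𝐕(Y, φ) = ½·sin φ·φ·φ + cos φ` (`potM_toyTable` — the (1.42) split
read back), `‖toyTable‖ ≤ 1` (`norm_toyTable_le`), completeness of `B13HistM toyFrame` by instance, and the weak-measurability
clause of `T4InputCauchyRateTermwise.TermHistExpLinear` for the functional `Λ(a) = Σ_{Y ∈ D} τ(Y) • potCLMM Y a` against Lebesgue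
measure on `ℝ`, for EVERY table `h` (`toy_weak_measurability`) — so `MeasPotFrame`, `B13HistM`, `ofMeasPotentials` and
`aestronglyMeasurable_sum_smul_potCLMM` are jointly instantiable.  0 sorry; axioms ⊆ {propext, Classical.choice, Quot.sound}.
-/

noncomputable section

open scoped BigOperators
open Finset MeasureTheory

namespace Summit.QuantumFields.BalabanUV.T4Continuum.B13HistWitness

open Literature.MathematicalPhysics.QuantumFieldTheory.Balaban1983to89
open Summit.QuantumFields.BalabanUV.T4Continuum.B13HistDatum
open Summit.QuantumFields.BalabanUV.T4Continuum.B13HistMeasurable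
open Summit.QuantumFields.BalabanUV.T4Continuum.InsertionLinearClass (linToyCarriers)

/-- [folklore] All-ones toy constants (`L = 2`, `q = 1`, every real constant `1` except `δ = C₂ = 0`): a choice under which
both printed level formats are `1` at tree length `0`; NOT Bałaban's constants. -/
def toyConsts : B13.Consts where
  L := 2
  q := 1
  M := 1
  κ := 1
  κ₁ := 1
  δ := 0
  δ₀ := 1
  E₀ := 1
  ε₁ := 1
  C₁ := 1
  C₂ := 0
  C₃ := 1
  α₀ := 1
  α₁ := 1
  α₄ := 1
  α₅ := 1
  α₆ := 1
  γ₂ := 1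
  γ := 1
  A₁ := 1
  A₂ := 1

/-- [folklore] The toy constants satisfy `PosUnits`. -/
theorem toy_posUnits : PosUnits toyConsts := ⟨one_pos, one_pos, one_pos, one_pos, one_pos⟩

/-- [folklore] At tree length `0` the (1.36) format of the toy constants is `1`. -/
@[simp] theorem level136_toy : level136 toyConsts 0 = 1 := by
  simp [level136, toyConsts]

/-- [folklore] At tree length `0` and cube count `0` the (1.43) format of the toy constants is `1`. -/
@[simp] theorem level143_toy : level143 toyConsts 0 0 = 1 := by
  simp [level143, toyConsts]

/-- [folklore] THE TOY MEASURABLE POTENTIAL FRAME over the toy carriers: arguments `ℝ` (Borel), one bond per domain with bond variable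
`Bv Y φ () = φ`, cube count `0`, the all-ones constants. -/
def toyFrame : MeasPotFrame linToyCarriers where
  Arg _ := ℝ
  Bond _ := Unit
  finBond _ := inferInstance
  Bv _ φ _ := (φ : ℂ)
  vol _ := 0
  consts := toyConsts
  pos := toy_posUnits
  meas _ := inferInstance
  measurable_Bv _ _ := Complex.measurable_ofReal

/-- [folklore] The toy frame's (1.36) weight at every domain is `1`. -/
@[simp] theorem level136_toyFrame (Y : ℕ) : level136 toyFrame.consts (linToyCarriers.d Y) = 1 := level136_toy

/-- [folklore] The toy frame's (1.43) weight at every domain is `1`. -/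
@[simp] theorem level143_toyFrame (Y : ℕ) : level143 toyFrame.consts (linToyCarriers.d Y) (toyFrame.vol Y) = 1 := level143_toy

/-- [folklore] The remainder potentials of the toy table: `V″(Y, φ) = cos φ`. -/
def toyV : (Y : ℕ) → toyFrame.Arg Y → ℂ := fun _ φ => (Real.cos φ : ℂ)

/-- [folklore] The kernel entries of the toy table: `Q(Y, φ, (), ()) = sin φ`. -/
def toyQ : (Y : ℕ) → toyFrame.Arg Y → toyFrame.Bond Y → toyFrame.Bond Y → ℂ := fun _ φ _ _ => (Real.sin φ : ℂ)

/-- [folklore] `|cos φ| ≤ 1 ×` the (1.36) weight. -/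
theorem toyV_bound (Y : ℕ) (φ : toyFrame.Arg Y) : ‖toyV Y φ‖ ≤ 1 * level136 toyFrame.consts (linToyCarriers.d Y) := by
  rw [level136_toyFrame, one_mul, toyV, Complex.norm_real, Real.norm_eq_abs]
  exact Real.abs_cos_le_one φ

/-- [folklore] `|sin φ| ≤ 1 ×` the (1.43) weight. -/
theorem toyQ_bound (Y : ℕ) (φ : toyFrame.Arg Y) (b b' : toyFrame.Bond Y) :
    ‖toyQ Y φ b b'‖ ≤ 1 * level143 toyFrame.consts (linToyCarriers.d Y) (toyFrame.vol Y) := by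
  rw [level143_toyFrame, one_mul, toyQ, Complex.norm_real, Real.norm_eq_abs]
  exact Real.abs_sin_le_one φ

/-- [folklore] `φ ↦ cos φ` is measurable. -/
theorem toyV_measurable (Y : ℕ) : Measurable (toyV Y) := Complex.measurable_ofReal.comp Real.measurable_cos

/-- [folklore] `φ ↦ sin φ` is measurable. -/
theorem toyQ_measurable (Y : ℕ) (b b' : toyFrame.Bond Y) : Measurable fun φ => toyQ Y φ b b' :=
  Complex.measurable_ofReal.comp Real.measurable_sin

/-- [folklore] THE TOY MEASURABLE TABLE, built by row O1-c's constructor `ofMeasPotentials` with the factor `μ = 1`. -/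
def toyTable : B13HistM toyFrame :=
  toyFrame.ofMeasPotentials toyV toyQ 1 toyV_bound toyQ_bound toyV_measurable toyQ_measurable

/-- [folklore] The constructor reproduces `V″ = cos`. -/
@[simp] theorem VppM_toyTable (Y : ℕ) (φ : ℝ) : toyFrame.VppM toyTable Y φ = (Real.cos φ : ℂ) :=
  toyFrame.VppM_ofMeasPotentials _ _ _ _ _ _ _ Y φ

/-- [folklore] The constructor reproduces `Q = sin`. -/
@[simp] theorem QkerM_toyTable (Y : ℕ) (φ : ℝ) (b b' : Unit) : toyFrame.QkerM toyTable Y φ b b' = (Real.sin φ : ℂ) :=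
  toyFrame.QkerM_ofMeasPotentials _ _ _ _ _ _ _ Y φ b b'

/-- [folklore] THE (1.42) SPLIT READ BACK: the toy table's potential value is `𝐕(Y, φ) = ½·(sin φ·φ·φ) + cos φ`. -/
theorem potM_toyTable (Y : ℕ) (φ : ℝ) :
    toyFrame.potM toyTable Y φ = (1 / 2 : ℂ) * ((Real.sin φ : ℂ) * (φ : ℂ) * (φ : ℂ)) + (Real.cos φ : ℂ) := by
  have hQ : ∀ b b' : Unit, toyFrame.Qker toyTable.1 Y φ b b' = (Real.sin φ : ℂ) := QkerM_toyTable Y φ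
  have hV : toyFrame.Vpp toyTable.1 Y φ = (Real.cos φ : ℂ) := VppM_toyTable Y φ
  have hBv : ∀ b : Unit, toyFrame.Bv Y φ b = (φ : ℂ) := fun _ => rfl
  change (1 / 2 : ℂ) * (∑ b : Unit, ∑ b' : Unit, toyFrame.Qker toyTable.1 Y φ b b' * toyFrame.Bv Y φ b * toyFrame.Bv Y φ b')
      + toyFrame.Vpp toyTable.1 Y φ = _
  simp only [hQ, hV, hBv, Fintype.sum_unique]

/-- [folklore] The toy table lies in the unit ball (the dictionary with `μ = 1`). -/
theorem norm_toyTable_le : ‖toyTable‖ ≤ 1 :=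
  toyFrame.norm_ofMeasPotentials_le _ _ zero_le_one _ _ _ _

/-- [folklore] The measurable history space of the toy frame is complete (instance found). -/
example : CompleteSpace (B13HistM toyFrame) := inferInstance

/-- [folklore] **THE WEAK-MEASURABILITY CLAUSE, INSTANTIATED**: for every finite set of domains `D`, complex weights `τ`, and EVERY
measurable table `h`, the functional `Λ(a) = Σ_{Y ∈ D} τ(Y) • potCLMM Y a` (field map = identity on `ℝ`) satisfies
`AEStronglyMeasurable (fun a ↦ Λ a h) volume` — the second conjunct of `T4InputCauchyRateTermwise.TermHistExpLinear` verbatim. -/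
theorem toy_weak_measurability (D : Finset ℕ) (τ : ℕ → ℂ) (h : B13HistM toyFrame) :
    AEStronglyMeasurable (fun a : ℝ => (∑ Y ∈ D, τ Y • toyFrame.potCLMM Y a) h) volume :=
  toyFrame.aestronglyMeasurable_sum_smul_potCLMM volume D τ (B := fun _ a => a) (fun _ => measurable_id) h

/-- [folklore] … together with the operator-norm bound of the third conjunct: `‖Λ(a)‖ ≤ Σ_{Y ∈ D} ‖τ Y‖·potWt Y a`. -/
theorem toy_norm_bound (D : Finset ℕ) (τ : ℕ → ℂ) (a : ℝ) :
    ‖∑ Y ∈ D, τ Y • toyFrame.potCLMM Y a‖ ≤ ∑ Y ∈ D, ‖τ Y‖ * toyFrame.potWt Y a :=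
  toyFrame.norm_sum_smul_potCLMM_le D τ fun _ => a

end Summit.QuantumFields.BalabanUV.T4Continuum.B13HistWitness

end
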